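import Mathlib
import HarnessLib
import Summits.HubbardSuperconductivity.HubbardSuperconductivity.Theorems.KLProgrammeKLRegimeEngineTwoLegBudgetDecay

/-!
# Route `KLProgramme` — ENGINE child gen 8 (stmt-HubbardSuperconductivity-20437 `KLRegimeEngineV17F2`), SKELETON v2 class #3 (E.5 share):
# the BUDGET ARITHMETIC of the cubic remainder in the running-coupling currency — `Σ_j ε_j³·2^{−j}` is `O((Klam·U)³)` n-free, and its
# windowed tails are `≤ 52·ε_a³·2^{−a}` (cell gate-hubbard-kl, seat p5 g10; FINDING (E5-EPS), KL STATUS 2026-08-27; the cubic twin of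
# k3c2-p3's `…EngineTwoLegBudgetDecay`)

WHY.  The E.5 classes of stub (c) (two-vertex cross contractions, ≥ 3 lines) are budgeted per step in `eremBar`'s `Q.CR·(P.Klam·|U|)³·2^{−n}`
(…SplitConsts), and child 1 reads them through the windowed sums `Σ_{n ∈ Ico a b} ē_n ≤ … + CR·(Klam|U|)³·2·(1/2)^a + …`
(`klbf_sum_Ico_eremBar_le`).  With the sextic/octic kernels known only at the sign-blind running coupling `ε_j = epsCoupling P U j = Klam·(|U| + U²·j)`
(E1 tower, `KernelNormsLevels`), the honest per-step size of the E.5 share is `C·ε_{n−2}³·2^{−n}` (…EngineV8E5WitnessRowsG §12), whose ratio to the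
U-cube `(1 + U(n−2))³` is unbounded in the regime.  This file records what the ε-cube budget DOES give — the same low-scale dominance as the two-leg
line (`Σ ε_j²·2^{−j} ≤ 12·Klam²·U²`): the TOTAL is U-cubed and n-free, and every WINDOW is controlled by the coupling at its top scale:

* §1 `sum_range_cube_mul_half_pow_eq/_le` (`Σ_{j<n} j³·(1/2)^j = 26 − (n³+3n²+9n+13)·2·(1/2)^n ≤ 26`),
  `sum_range_succ_cube_mul_half_pow_le` (`Σ_{i<m} (i+1)³·(1/2)^i ≤ 52`);
* §2 **`sum_Ico_epsCoupling_cube_mul_inv_two_pow_le`**: `|U| ≤ 1 ⇒ Σ_{j ∈ Ico a b} ε_j³·(2^j)⁻¹ ≤ 52·ε_a³·(2^a)⁻¹` (any `a ≤ b`; `ε_{a+i} ≤ ε_a·(1+i)`),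
  **`sum_range_epsCoupling_cube_mul_inv_two_pow_le`**: `Σ_{j<n} ε_j³·(2^j)⁻¹ ≤ 52·(Klam·|U|)³` — n-FREE and U-cubed;
* §3 `epsCoupling_cube_mul_inv_two_pow_le_of_le_inv` — at the shallow scales `U·j ≤ 1` the ε-cube IS a U-cube per step: `ε_j³·2^{−j} ≤ 8·(Klam|U|)³·2^{−j}`.

Pure real analysis; no definitions; nothing about the model is asserted; nothing asserts superconductivity.
References: BGM 2006 §2.8 (2.80), Lemma 2.5 (2.98) [cite: BenfattoGiulianiMastropietro2006].
-/

noncomputable section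

namespace Summit.HubbardSuperconductivity.HubbardSuperconductivity.Theorems.EngineV8

set_option linter.dupNamespace false -- summit = problem name (single-conjunct summit), D-0017

open Real Finset
open Summit.HubbardSuperconductivity.HubbardSuperconductivity.Theorems.KLRegimeSplit

/-! ## §1 The cubic-weight geometric sums (closed form and the bounds `26`, `52`) -/

/-- `Σ_{j<n} j³·(1/2)^j = 26 − (n³ + 3n² + 9n + 13)·2·(1/2)^n`. [folklore] -/
theorem sum_range_cube_mul_half_pow_eq (n : ℕ) :
    ∑ j ∈ range n, (j : ℝ) ^ 3 * (1 / 2 : ℝ) ^ j = 26 - ((n : ℝ) ^ 3 + 3 * (n : ℝ) ^ 2 + 9 * n + 13) * 2 * (1 / 2 : ℝ) ^ n := by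
  induction n with
  | zero => norm_num
  | succ n ih => rw [sum_range_succ, ih]; push_cast; ring

/-- `Σ_{j<n} j³·(1/2)^j ≤ 26`. [folklore] -/
theorem sum_range_cube_mul_half_pow_le (n : ℕ) : ∑ j ∈ range n, (j : ℝ) ^ 3 * (1 / 2 : ℝ) ^ j ≤ 26 := by
  rw [sum_range_cube_mul_half_pow_eq]
  have : (0 : ℝ) ≤ ((n : ℝ) ^ 3 + 3 * (n : ℝ) ^ 2 + 9 * n + 13) * 2 * (1 / 2 : ℝ) ^ n := by positivity
  linarith

/-- `Σ_{i<m} (i+1)³·(1/2)^i ≤ 52` (`= 2 + 3·2 + 3·6 + 26` from the four weighted geometric sums). [folklore] -/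
theorem sum_range_succ_cube_mul_half_pow_le (m : ℕ) : ∑ i ∈ range m, ((i : ℝ) + 1) ^ 3 * (1 / 2 : ℝ) ^ i ≤ 52 := by
  have h0 : ∑ i ∈ range m, (1 / 2 : ℝ) ^ i ≤ 2 := by
    rw [sum_range_half_pow_eq]
    have : (0 : ℝ) ≤ 2 * (1 / 2 : ℝ) ^ m := by positivity
    linarith
  have h1 := sum_range_mul_half_pow_le_two m
  have h2 := sum_range_sq_mul_half_pow_le_six m
  have h3 := sum_range_cube_mul_half_pow_le m
  have hsplit : ∑ i ∈ range m, ((i : ℝ) + 1) ^ 3 * (1 / 2 : ℝ) ^ i =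
      ∑ i ∈ range m, (i : ℝ) ^ 3 * (1 / 2 : ℝ) ^ i + 3 * ∑ i ∈ range m, (i : ℝ) ^ 2 * (1 / 2 : ℝ) ^ i +
        3 * ∑ i ∈ range m, (i : ℝ) * (1 / 2 : ℝ) ^ i + ∑ i ∈ range m, (1 / 2 : ℝ) ^ i := by
    rw [mul_sum, mul_sum, ← sum_add_distrib, ← sum_add_distrib, ← sum_add_distrib]
    exact sum_congr rfl fun i _ => by ring
  rw [hsplit]
  linarith

/-! ## §2 The ε-cube budget: windowed tails and the n-free total -/

/-- `ε_{a+i} ≤ ε_a·(1 + i)` for `|U| ≤ 1`, `0 ≤ Klam` (`U² ≤ |U| ≤ |U| + U²a`). [folklore] -/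
theorem epsCoupling_add_le (P : SplitConsts) (hK : 0 ≤ P.Klam) {U : ℝ} (hU : |U| ≤ 1) (a i : ℕ) :
    epsCoupling P U (a + i) ≤ epsCoupling P U a * (1 + i) := by
  unfold epsCoupling
  have hU0 : 0 ≤ |U| := abs_nonneg U
  have hU2 : U ^ 2 ≤ |U| := by
    rw [← sq_abs]; nlinarith
  have hA : U ^ 2 ≤ |U| + U ^ 2 * a := hU2.trans (le_add_of_nonneg_right (by positivity))
  have hi : (0 : ℝ) ≤ i := by positivity
  push_cast
  have key : |U| + U ^ 2 * (a + i) ≤ (|U| + U ^ 2 * a) * (1 + i) := by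
    have h := mul_le_mul_of_nonneg_right hA hi
    calc |U| + U ^ 2 * ((a : ℝ) + i) = (|U| + U ^ 2 * a) + U ^ 2 * i := by ring
      _ ≤ (|U| + U ^ 2 * a) + (|U| + U ^ 2 * a) * i := by linarith [h]
      _ = (|U| + U ^ 2 * a) * (1 + i) := by ring
  calc P.Klam * (|U| + U ^ 2 * ((a : ℝ) + i)) ≤ P.Klam * ((|U| + U ^ 2 * a) * (1 + i)) := mul_le_mul_of_nonneg_left key hK
    _ = P.Klam * (|U| + U ^ 2 * a) * (1 + i) := by ring

/-- **Windowed tails of the ε-cube budget**: `|U| ≤ 1`, `0 ≤ Klam` ⇒ `Σ_{j ∈ Ico a b} ε_j³·(2^j)⁻¹ ≤ 52·ε_a³·(2^a)⁻¹` — the window is controlled by the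
running coupling AT ITS TOP SCALE (against child 1's `2·(1/2)^a` for the U-cube line of `klbf_sum_Ico_eremBar_le`). [folklore] -/
theorem sum_Ico_epsCoupling_cube_mul_inv_two_pow_le (P : SplitConsts) (hK : 0 ≤ P.Klam) {U : ℝ} (hU : |U| ≤ 1) (a b : ℕ) :
    ∑ j ∈ Ico a b, epsCoupling P U j ^ 3 * ((2 : ℝ) ^ j)⁻¹ ≤ 52 * epsCoupling P U a ^ 3 * ((2 : ℝ) ^ a)⁻¹ := by
  have hε0 : 0 ≤ epsCoupling P U a := by unfold epsCoupling; positivity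
  rw [sum_Ico_eq_sum_range]
  have hterm : ∀ i ∈ range (b - a), epsCoupling P U (a + i) ^ 3 * ((2 : ℝ) ^ (a + i))⁻¹ ≤
      epsCoupling P U a ^ 3 * ((2 : ℝ) ^ a)⁻¹ * (((i : ℝ) + 1) ^ 3 * (1 / 2 : ℝ) ^ i) := by
    intro i _
    have h1 : epsCoupling P U (a + i) ^ 3 ≤ (epsCoupling P U a * (1 + i)) ^ 3 :=
      pow_le_pow_left₀ (by unfold epsCoupling; positivity) (epsCoupling_add_le P hK hU a i) 3
    have h2 : ((2 : ℝ) ^ (a + i))⁻¹ = ((2 : ℝ) ^ a)⁻¹ * (1 / 2 : ℝ) ^ i := by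
      rw [pow_add, mul_inv, one_div, inv_pow]
    rw [h2]
    calc epsCoupling P U (a + i) ^ 3 * (((2 : ℝ) ^ a)⁻¹ * (1 / 2 : ℝ) ^ i)
        ≤ (epsCoupling P U a * (1 + i)) ^ 3 * (((2 : ℝ) ^ a)⁻¹ * (1 / 2 : ℝ) ^ i) := mul_le_mul_of_nonneg_right h1 (by positivity)
      _ = epsCoupling P U a ^ 3 * ((2 : ℝ) ^ a)⁻¹ * (((i : ℝ) + 1) ^ 3 * (1 / 2 : ℝ) ^ i) := by ring
  refine (sum_le_sum hterm).trans ?_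
  rw [← mul_sum]
  have h52 := sum_range_succ_cube_mul_half_pow_le (b - a)
  have h0 : 0 ≤ epsCoupling P U a ^ 3 * ((2 : ℝ) ^ a)⁻¹ := by positivity
  calc epsCoupling P U a ^ 3 * ((2 : ℝ) ^ a)⁻¹ * ∑ i ∈ range (b - a), ((i : ℝ) + 1) ^ 3 * (1 / 2 : ℝ) ^ i
      ≤ epsCoupling P U a ^ 3 * ((2 : ℝ) ^ a)⁻¹ * 52 := mul_le_mul_of_nonneg_left h52 h0
    _ = 52 * epsCoupling P U a ^ 3 * ((2 : ℝ) ^ a)⁻¹ := by ring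

/-- **The n-free total**: `|U| ≤ 1`, `0 ≤ Klam` ⇒ `Σ_{j<n} ε_j³·(2^j)⁻¹ ≤ 52·(Klam·|U|)³` — the cubic remainder is U-cubed IN SUM (low-scale dominance),
though not per step. [folklore] -/
theorem sum_range_epsCoupling_cube_mul_inv_two_pow_le (P : SplitConsts) (hK : 0 ≤ P.Klam) {U : ℝ} (hU : |U| ≤ 1) (n : ℕ) :
    ∑ j ∈ range n, epsCoupling P U j ^ 3 * ((2 : ℝ) ^ j)⁻¹ ≤ 52 * (P.Klam * |U|) ^ 3 := by
  have h := sum_Ico_epsCoupling_cube_mul_inv_two_pow_le P hK hU 0 n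
  have h0 : epsCoupling P U 0 = P.Klam * |U| := by simp [epsCoupling]
  rw [Nat.Ico_zero_eq_range, h0, pow_zero, inv_one, mul_one] at h
  exact h

/-! ## §3 At the shallow scales the ε-cube is a U-cube per step -/

/-- **Shallow scales** (`|U|·j ≤ 1`, `0 ≤ Klam`): `ε_j ≤ 2·Klam·|U|`, hence `ε_j³·(2^j)⁻¹ ≤ 8·(Klam·|U|)³·(2^j)⁻¹` — the U-cube line of `eremBar`
holds per step with `8·C` down to `j ≤ 1/|U|`; the excess `(1 + |U|j)³` lives only below. [folklore] -/
theorem epsCoupling_cube_mul_inv_two_pow_le_of_le_inv (P : SplitConsts) (hK : 0 ≤ P.Klam) {U : ℝ} {j : ℕ} (hj : |U| * j ≤ 1) :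
    epsCoupling P U j ^ 3 * ((2 : ℝ) ^ j)⁻¹ ≤ 8 * (P.Klam * |U|) ^ 3 * ((2 : ℝ) ^ j)⁻¹ := by
  have hε0 : 0 ≤ epsCoupling P U j := by unfold epsCoupling; positivity
  have h1 : epsCoupling P U j ≤ 2 * (P.Klam * |U|) := by
    unfold epsCoupling
    have hU0 : 0 ≤ |U| := abs_nonneg U
    have : U ^ 2 * (j : ℝ) = |U| * (|U| * j) := by rw [← sq_abs]; ring
    rw [this]
    have h2 : |U| * (|U| * (j : ℝ)) ≤ |U| * 1 := mul_le_mul_of_nonneg_left hj hU0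
    nlinarith
  have h3 : epsCoupling P U j ^ 3 ≤ (2 * (P.Klam * |U|)) ^ 3 := pow_le_pow_left₀ hε0 h1 3
  calc epsCoupling P U j ^ 3 * ((2 : ℝ) ^ j)⁻¹ ≤ (2 * (P.Klam * |U|)) ^ 3 * ((2 : ℝ) ^ j)⁻¹ :=
        mul_le_mul_of_nonneg_right h3 (by positivity)
    _ = 8 * (P.Klam * |U|) ^ 3 * ((2 : ℝ) ^ j)⁻¹ := by ring

end Summit.HubbardSuperconductivity.HubbardSuperconductivity.Theorems.EngineV8

end
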